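import Summits.CriticalPhenomena.PercolationContinuityZ3.Theorems.Transplant.SkelPhiFaceRouteReadings
import HarnessLib

/-!
# N1 ({±1} node), (F) inner route, part R5b-iii (hp-8 g33): **THE TARGET IS OFF THE ZONE** — the field `hMZ` of `FaceRunNums`: a vertex near the
# kit centre `c` (planar offsets `≤ sα, sβ`, hence base-`c` cell coordinate `≤ k` on the face's axis) is NOT in the small arrival box
# `VWin ψ w₀ (Mb b₀ (x+du)) R`, because its cell level is at most `lev(z_c) + k + 1` (base change of the fine skeleton) while every cell of
# `Mb b₀ (x+du)` has level at least `lev(cen (x+du)) − b₀ = 20·r∥ − b₀` — provided `lev(z_c) + k + 1 < 20 r∥ − b₀∥` (the contact sits near the face,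
# far below the arrival box).  Also: `lev` of the next cube's centre.
builds on p205010 (kernel theorem, internal audit signed; external expert review pending) — nothing in this file uses p205010; no claim about the open node.
Lane `prim-bschramm`, seat `prim-hp-8` (gen 33); helper file (`--supports stmt-CriticalPhenomena-4575 --as helper`).
* `PCells2.lev_cen_add_stepVec`, **`Skelφ.not_mem_MbWin_of_near`**, `Skelφ.disjoint_MbWin_of_near`.
[cite: KozmaNitzan2024, §4 p. 26 (M_v), Lemma 11 (p. 22)]
-/

noncomputable section

open scoped Classical

namespace Summit.CriticalPhenomena.PercolationContinuityZ3.Theorems.Transplant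

open Literature.Probability.Percolation Literature.Probability.LatticeModels KNCells
open Literature.Probability.Percolation.KozmaNitzan
open Literature.Probability.Percolation.KozmaNitzan.Cells (oth oth_ne sgOf sgOf_sign stepVec_apply_fst stepVec_apply_oth eq_oth_of_ne oth_oth)
open Literature.Barriers.CriticalPhenomena (graphBall)

/-- The next cube's centre sits at planar level `20·r∥`. [folklore] -/
theorem PCells2.lev_cen_add_stepVec (P : PCells2) (x : Site 2) (du : MDir) : P.lev du x (P.cen (x + stepVec du)) = 20 * (P.r du.1 : ℤ) := by
  unfold PCells2.lev PCells2.cen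
  rw [Pi.add_apply, stepVec_apply_fst]
  have hsq : sgOf du * sgOf du = 1 := by rcases sgOf_sign du with h | h <;> rw [h] <;> norm_num
  linear_combination (20 * (P.r du.1 : ℤ)) * hsq

namespace Skelφ

variable {V : Type} [DecidableEq V] {G : SimpleGraph V} [G.LocallyFinite] {φ : V → Site 2}

/-- **THE ARRIVAL BOX IS OFF THE NEAR ZONE**: a vertex whose base-`c` cell coordinate on the face's axis is at most `k` lies outside
`VWin ψ w₀ (Mb b₀ (x + du)) R` once `lev(z_c) + k + 1 < 20·r∥ − b₀∥`. [cite: KozmaNitzan2024, §4 p. 26, Lemma 11 (p. 22)] -/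
theorem not_mem_MbWin_of_near (P : PCells2) (w₀ c : V) (A n h vα vβ c₀ c₁ : ℤ) {D : ℤ} (hD : 0 < D) {x : Site 2} {du : MDir} {b₀ : Fin 2 → ℕ}
    {R : ℕ} {k Lc : ℤ} {v : V} (hk : |fineSkel φ c A n h vα vβ c₀ c₁ (D / 2) (D / 2) D v du.1| ≤ k)
    (hLc : P.lev du x (fineSkel φ w₀ A n h vα vβ c₀ c₁ (D / 2) (D / 2) D c) ≤ Lc) (hfar : Lc + k + 1 < 20 * (P.r du.1 : ℤ) - b₀ du.1) :
    v ∉ VWin G (fineSkel φ w₀ A n h vα vβ c₀ c₁ (D / 2) (D / 2) D) w₀ (P.Mb b₀ (x + stepVec du)) R := by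
  intro hv
  have hW := (mem_Win G _).1 (VWin_subset_Win w₀ _ _ hv)
  have hM := (PCells2.mem_Mb_iff (P := P)).1 hW.2 du.1
  have hbc := abs_le.1 (abs_fineSkel_base_change (φ := φ) w₀ c v A n h vα vβ c₀ c₁ hD du.1)
  have hk' := abs_le.1 hk
  have hcen := P.lev_cen_add_stepVec x du
  unfold PCells2.lev at hLc hcen
  have hσ := sgOf_sign du
  rcases hσ with hs | hs <;> rw [hs] at hLc hcen <;> nlinarith [hM.1, hM.2, hbc.1, hbc.2, hk'.1, hk'.2]

/-- **`hMZ`**: a finite set of near vertices (each within `k` on the face's axis) is disjoint from the arrival box. [folklore] -/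
theorem disjoint_MbWin_of_near (P : PCells2) (w₀ c : V) (A n h vα vβ c₀ c₁ : ℤ) {D : ℤ} (hD : 0 < D) {x : Site 2} {du : MDir}
    {b₀ : Fin 2 → ℕ} {R : ℕ} {k Lc : ℤ} {Z : Finset V} (hk : ∀ v ∈ Z, |fineSkel φ c A n h vα vβ c₀ c₁ (D / 2) (D / 2) D v du.1| ≤ k)
    (hLc : P.lev du x (fineSkel φ w₀ A n h vα vβ c₀ c₁ (D / 2) (D / 2) D c) ≤ Lc) (hfar : Lc + k + 1 < 20 * (P.r du.1 : ℤ) - b₀ du.1) :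
    Disjoint (VWin G (fineSkel φ w₀ A n h vα vβ c₀ c₁ (D / 2) (D / 2) D) w₀ (P.Mb b₀ (x + stepVec du)) R) Z :=
  Finset.disjoint_right.2 fun v hv => not_mem_MbWin_of_near P w₀ c A n h vα vβ c₀ c₁ hD (hk v hv) hLc hfar

end Skelφ

end Summit.CriticalPhenomena.PercolationContinuityZ3.Theorems.Transplant

end
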